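import Summits.QuantumFields.YangMills.Theorems.UnitScaleTiltProp7SymSliceWitness
import Summits.QuantumFields.YangMills.Theorems.UnitScaleTiltProp7SymFrameUnitary
import HarnessLib

/-!
# `UnitScaleTiltProp7SymSliceWitnessRegPr` — THE CHART-ΣS WITNESS AND THE RE-BASED (20) FULLY DISCHARGED AT PRINTED-REGULAR DATA: the displayed membership row `hSU`
# of ✓`Prop7SymSliceWitness.exists_normS_of_regPr` ∕ `avgCondPrintS_of_chart47twS` READ from ★w3-20520 g4's supplier ✓`Prop7SymFrameBound.frameTwS_mem_specialUnitaryUnits_of_regPr`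
# (route `UnitScaleTilt`, crux K1 «MinimiserStabilityRegPr» stmt-QuantumFields-19200, stub EX `stub_existenceMinimalOrbit`, route (α), node (α-S), OWNER RULING g26-№19 ∕ ACK 33;
# def-free, count-neutral, `--supports stmt-QuantumFields-19200 --as helper`)

Cell `ym3-torus` ∕ width seat `ym-ust-20520-w5` (gen 4).  YM₃ on T³ is ladder rung R3 (HUMAN RULING D-0037) — not d = 4, not a mass gap, not the Clay problem; nothing
here is a claim about the stub, the crux or the gap.

WHAT.  `…SymSliceWitness` proves `∃ u, NormS F n K h U₀ X U₁ u` (the symmetric slice's gauge transformation `ũ_S`: `(U₁U₀)^u ∈ Ax_k(𝔅_k, U₀)` with `u↓ = (w^{sym}_{iX})⁻¹`) and the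
re-based (20) `AvgCondPrintS` modulo ONE displayed row `hSU : ∀ y, frameTwS F n K h U₀ (I•X) y ∈ specialUnitaryUnits (Fin 2)` (the symmetric accumulated frame of `SU(2)` data is
special unitary).  `…SymFrameUnitary` (landed in parallel) supplies exactly that row for `RegPr F n K ε₀ U₀`, `10¹²L³ε₀ ≤ 1`, `10⁹L²e ≤ 1` and a bondwise self-adjoint traceless
`X` with `‖X(b)‖ ≤ e·η`.  This file composes the two BY NAME.

WHAT IS PROVED (sorry-free, no definition):
* ★★★`exists_normS_of_regPr_of_size` — `RegPr F n K ε₀ U₀`, `RegPr F n K ε₁ (U₁U₀)`, `10¹²L³ε₀ ≤ 1`, `10⁷L³ε₁ ≤ 1`, `10⁹L²e ≤ 1`, `X` self-adjoint traceless with `‖X(b)‖ ≤ e·η`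
  ⟹ `∃ u, NormS F n K h U₀ X U₁ u` — NO displayed row left.
* ★★`avgCondPrintS_of_chart47twS_of_size` — FILE Aˢ's (20) step with `hSU` discharged: the hypotheses of ✓`Prop7SymAvgTwSymEq137.fibreClauseS_of_chart47twS` verbatim (its `ε₀`-window
  strengthened to `10¹²L³ε₀ ≤ 1`) plus the (19)-size `‖X(b)‖ ≤ e·η`, `10⁹L²e ≤ 1` ⟹ `AvgCondPrintS F n K h V U₀ X`.
* ★`avgCondPrintS_of_mem_fibre_of_logChartTwS_eq_zero_of_size` — the EX case `U₀ ∈ 𝔅_k(V)`, `logChartTwS U₀ (iX) = 0`, likewise discharged.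
HONEST SCOPE.  Three compositions by name; no estimate, nothing of print asserted.  `--supports stmt-QuantumFields-19200 --as helper`.

References: T. Bałaban, CMP **102** (1985) 277–309 [Balaban1985Variational] ((2) p.278, (19)–(20) p.281, (47)–(49) p.285); CMP **99** (1985) 75–102 [Balaban1985RegularSpaces]
((1.19) p.79, (1.28)–(1.31) pp.81–82, (1.37) p.82); CMP **98** (1985) 17–51 [Balaban1985Averaging] ((87)–(92) p.31, (97) p.32).
-/

set_option autoImplicit false

noncomputable section

namespace Summit.QuantumFields.YangMills.Theorems.Prop7SymSliceWitness

open NormedSpace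
open Literature.MathematicalPhysics.QuantumFieldTheory.Balaban1983to89

section T3

open scoped Matrix.Norms.L2Operator
open Literature.MathematicalPhysics.QuantumFieldTheory.Balaban1983to89.T3ContinuumYM3Torus
open Literature.MathematicalPhysics.QuantumFieldTheory.Balaban1983to89.T3UnitLawDensityEML (ℰp)
open Literature.MathematicalPhysics.QuantumFieldTheory.Balaban1983to89.T3PrintedRegularMinimiser (RegPr)
open Literature.MathematicalPhysics.QuantumFieldTheory.Balaban1983to89.T3PrintedRegularOrbits (descTransf sites_eq)
open Literature.MathematicalPhysics.QuantumFieldTheory.Balaban1983to89.T3ConstrainedMinimiser (fibre)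
open Literature.MathematicalPhysics.QuantumFieldTheory.Balaban1983to89.T3TiltDescent (descendTo)
open B7Prop2SpecialUnitary (specialUnitaryUnits)
open B10Eq27TorusAxialLog (unitsField toUField)
open B11Prop3Model (Dfix)
open MatrixLog (mlog)
open T3SectALandauChart (emb15 eta)
open Summit.QuantumFields.YangMills.Theorems.Prop7SPrint (NormS AvgCondPrintS)
open Summit.QuantumFields.YangMills.Theorems.Prop7TPrint (expHermField)
open Summit.QuantumFields.YangMills.Theorems.Prop7SymAvgTwSym (frameTwS dbarTwS logChartTwS QTwS CmapTwS Chart47T3twS)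
open Summit.QuantumFields.YangMills.Theorems.Prop7SymFrameBound (frameTwS_mem_specialUnitaryUnits_of_regPr)

variable (F : T3Family) {n K : ℕ} (h : n ≤ K)

/-- `10¹²L³ε ≤ 1` implies the weaker cell window `10⁷L³ε ≤ 1` (`ε ≥ 0`). [cite: Balaban1985Variational, (2) p.278] -/
theorem ten7_of_ten12 {ε : ℝ} (hε : 0 ≤ ε) (h12 : 10 ^ 12 * (F.L : ℝ) ^ 3 * ε ≤ 1) : 10 ^ 7 * (F.L : ℝ) ^ 3 * ε ≤ 1 :=
  le_trans (by nlinarith [mul_nonneg (pow_nonneg (Nat.cast_nonneg (F.L) : (0 : ℝ) ≤ F.L) 3) hε]) h12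

/-- The displayed row `hSU` READ from ★w3-20520 g4's supplier: at a printed-regular background (`10¹²L³ε₀ ≤ 1`) and a bondwise self-adjoint traceless datum of (19)-size
`‖X(b)‖ ≤ e·η` (`10⁹L²e ≤ 1`), every symmetric accumulated frame `w^{sym}_{iX}(y)` is special unitary. [cite: Balaban1985Averaging, (97) p.32; Balaban1985Variational, (19) p.281] -/
theorem hSU_of_regPr {ε₀ e : ℝ} (hε₀ : 0 < ε₀) (hε₀' : 10 ^ 12 * (F.L : ℝ) ^ 3 * ε₀ ≤ 1) (he : 0 ≤ e) (he9 : 10 ^ 9 * (F.L : ℝ) ^ 2 * e ≤ 1)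
    {U₀ : GaugeField (F.P K) 0 (Matrix.specialUnitaryGroup (Fin 2) ℂ)} (hU₀ : RegPr F n K ε₀ U₀)
    {X : PBond (F.P K) 0 → Matrix (Fin 2) (Fin 2) ℂ} (hX : ∀ b : PBond (F.P K) 0, (X b).IsHermitian ∧ Matrix.trace (X b) = 0)
    (hXe : ∀ b : PBond (F.P K) 0, ‖X b‖ ≤ e * eta F n K) :
    ∀ y : Site (F.P n) 0, frameTwS F n K h U₀ (fun b => Complex.I • X b) y ∈ specialUnitaryUnits (Fin 2) := fun y =>
  frameTwS_mem_specialUnitaryUnits_of_regPr F h hε₀ he hε₀' he9 U₀ hU₀ X (fun b => (hX b).1) (fun b => (hX b).2) hXe y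

/-- ★★★ **THE CHART-ΣS WITNESS, FULLY DISCHARGED AT PRINTED-REGULAR DATA**: `U₀ ∈ 𝔘_k(ε₀)` (`10¹²L³ε₀ ≤ 1`), `U₁U₀ ∈ 𝔘_k(ε₁)` (`10⁷L³ε₁ ≤ 1`), `X` bondwise Hermitian traceless of
(19)-size `‖X(b)‖ ≤ e·η` (`10⁹L²e ≤ 1`) ⟹ there is a fine `SU(2)` gauge transformation `u` with `NormS F n K h U₀ X U₁ u` — `(U₁U₀)^u ∈ Ax_k(𝔅_k, U₀)` and
`u↓(y) = (w^{sym}_{iX}(y))⁻¹` (✓`exists_normS_of_regPr` ∘ `hSU_of_regPr`). [cite: Balaban1985RegularSpaces, (1.19) p.79, (1.28)–(1.30) p.81; Balaban1985Averaging, (87) p.31; Balaban1985Variational, (2) p.278, (20) p.281] -/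
theorem exists_normS_of_regPr_of_size {ε₀ ε₁ e : ℝ} (hε₀ : 0 < ε₀) (hε₀' : 10 ^ 12 * (F.L : ℝ) ^ 3 * ε₀ ≤ 1)
    (hε₁ : 0 < ε₁) (hε₁' : 10 ^ 7 * (F.L : ℝ) ^ 3 * ε₁ ≤ 1) (he : 0 ≤ e) (he9 : 10 ^ 9 * (F.L : ℝ) ^ 2 * e ≤ 1)
    {U₀ : GaugeField (F.P K) 0 (Matrix.specialUnitaryGroup (Fin 2) ℂ)} (hU₀ : RegPr F n K ε₀ U₀)
    {X : PBond (F.P K) 0 → Matrix (Fin 2) (Fin 2) ℂ} (hX : ∀ b : PBond (F.P K) 0, (X b).IsHermitian ∧ Matrix.trace (X b) = 0)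
    (hXe : ∀ b : PBond (F.P K) 0, ‖X b‖ ≤ e * eta F n K)
    {U₁ : GaugeField (F.P K) 0 (Matrix.specialUnitaryGroup (Fin 2) ℂ)} (hU₁ : RegPr F n K ε₁ (emb15 U₀ U₁)) :
    ∃ u : GaugeTransf (F.P K) 0 (Matrix.specialUnitaryGroup (Fin 2) ℂ), NormS F n K h U₀ X U₁ u :=
  exists_normS_of_regPr F h hε₀ (ten7_of_ten12 F hε₀.le hε₀') hε₁ hε₁' hU₀ X hU₁ (hSU_of_regPr F h hε₀ hε₀' he he9 hU₀ hX hXe)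

/-- ★★ **FILE Aˢ's (20) STEP, FULLY DISCHARGED** (RULING g26-№19 ORDER (2)(i)): the hypotheses of ✓`Prop7SymAvgTwSymEq137.fibreClauseS_of_chart47twS` verbatim (`ε₀`-window
`10¹²L³ε₀ ≤ 1`) plus the (19)-size of the chart image `‖X(b)‖ ≤ e·η`, `10⁹L²e ≤ 1` ⟹ `AvgCondPrintS F n K h V U₀ X` (✓`avgCondPrintS_of_chart47twS` ∘ `hSU_of_regPr`).
[cite: Balaban1985Variational, (47)–(49) p.285, (19)–(20) p.281, Prop. 3 p.289; Balaban1985RegularSpaces, (1.28)–(1.31) pp.81–82, (1.37) p.82] -/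
theorem avgCondPrintS_of_chart47twS_of_size {C₂ ε ε₀ ε₁ e : ℝ} (hε₀ : 0 < ε₀) (hε₀' : 10 ^ 12 * (F.L : ℝ) ^ 3 * ε₀ ≤ 1)
    (hε₁ : 0 < ε₁) (hε₁' : 10 ^ 7 * (F.L : ℝ) ^ 3 * ε₁ ≤ 1) (he : 0 ≤ e) (he9 : 10 ^ 9 * (F.L : ℝ) ^ 2 * e ≤ 1)
    {U₀ : GaugeField (F.P K) 0 (Matrix.specialUnitaryGroup (Fin 2) ℂ)} (hU₀ : RegPr F n K ε₀ U₀)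
    {H : (PBond (F.P n) 0 → Matrix (Fin 2) (Fin 2) ℂ) →ₗ[ℂ] (PBond (F.P K) 0 → Matrix (Fin 2) (Fin 2) ℂ)}
    (h47 : Chart47T3twS F n K h C₂ ε U₀ H) (hQH : ∀ Y, QTwS F n K h U₀ (H Y) = Y)
    (V : GaugeField (F.P n) 0 (Matrix.specialUnitaryGroup (Fin 2) ℂ))
    (A' : PBond (F.P K) 0 → Matrix (Fin 2) (Fin 2) ℂ) (hA' : ‖A'‖ < ε)
    (hQA' : QTwS F n K h U₀ A'
      = fun c => mlog (((unitsField (toUField V) c * (unitsField (toUField (descendTo F ℰp n K h U₀)) c)⁻¹ : (Matrix (Fin 2) (Fin 2) ℂ)ˣ) : Matrix (Fin 2) (Fin 2) ℂ)))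
    {X : PBond (F.P K) 0 → Matrix (Fin 2) (Fin 2) ℂ} (hX : ∀ b : PBond (F.P K) 0, (X b).IsHermitian ∧ Matrix.trace (X b) = 0)
    (hXe : ∀ b : PBond (F.P K) 0, ‖X b‖ ≤ e * eta F n K)
    (hAX : A' - H (Dfix (CmapTwS F n K h U₀) H C₂ A') = fun b => Complex.I • X b)
    (hU₁ : RegPr F n K ε₁ (emb15 U₀ (expHermField X)))
    (hwin : ∀ c : PBond (F.P n) 0, ‖((dbarTwS F n K h U₀ (fun b => Complex.I • X b) c : (Matrix (Fin 2) (Fin 2) ℂ)ˣ) : Matrix (Fin 2) (Fin 2) ℂ) - 1‖ < 1)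
    (hwinV : ∀ c : PBond (F.P n) 0,
      ‖((unitsField (toUField V) c * (unitsField (toUField (descendTo F ℰp n K h U₀)) c)⁻¹ : (Matrix (Fin 2) (Fin 2) ℂ)ˣ) : Matrix (Fin 2) (Fin 2) ℂ) - 1‖ < 1) :
    AvgCondPrintS F n K h V U₀ X :=
  avgCondPrintS_of_chart47twS F h hε₀ (ten7_of_ten12 F hε₀.le hε₀') hε₁ hε₁' hU₀ h47 hQH V A' hA' hQA' hX hAX hU₁ hwin hwinV
    (hSU_of_regPr F h hε₀ hε₀' he he9 hU₀ hX hXe)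

/-- ★ **THE EX-STUB CASE `U₀ ∈ 𝔅_k(V)`, FULLY DISCHARGED**: background in the fibre, `logChartTwS U₀ (iX) = 0`, the `dbarTwS` window, `e^{iX}U₀` printed-regular, `X` Hermitian traceless
of (19)-size `‖X(b)‖ ≤ e·η` ⟹ `AvgCondPrintS F n K h V U₀ X` (✓`avgCondPrintS_of_mem_fibre_of_logChartTwS_eq_zero` ∘ `hSU_of_regPr`).
[cite: Balaban1985RegularSpaces, (1.13) p.78, (1.37) p.82; Balaban1985Variational, (19)–(20) p.281] -/
theorem avgCondPrintS_of_mem_fibre_of_logChartTwS_eq_zero_of_size {ε₀ ε₁ e : ℝ} (hε₀ : 0 < ε₀) (hε₀' : 10 ^ 12 * (F.L : ℝ) ^ 3 * ε₀ ≤ 1)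
    (hε₁ : 0 < ε₁) (hε₁' : 10 ^ 7 * (F.L : ℝ) ^ 3 * ε₁ ≤ 1) (he : 0 ≤ e) (he9 : 10 ^ 9 * (F.L : ℝ) ^ 2 * e ≤ 1)
    {V : GaugeField (F.P n) 0 (Matrix.specialUnitaryGroup (Fin 2) ℂ)}
    {U₀ : GaugeField (F.P K) 0 (Matrix.specialUnitaryGroup (Fin 2) ℂ)} (hU₀V : U₀ ∈ fibre F ℰp n K h V) (hU₀ : RegPr F n K ε₀ U₀)
    {X : PBond (F.P K) 0 → Matrix (Fin 2) (Fin 2) ℂ} (hX : ∀ b : PBond (F.P K) 0, (X b).IsHermitian ∧ Matrix.trace (X b) = 0)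
    (hXe : ∀ b : PBond (F.P K) 0, ‖X b‖ ≤ e * eta F n K)
    (hU₁ : RegPr F n K ε₁ (emb15 U₀ (expHermField X)))
    (hwin : ∀ c : PBond (F.P n) 0, ‖((dbarTwS F n K h U₀ (fun b => Complex.I • X b) c : (Matrix (Fin 2) (Fin 2) ℂ)ˣ) : Matrix (Fin 2) (Fin 2) ℂ) - 1‖ < 1)
    (hlog : logChartTwS F n K h U₀ (fun b => Complex.I • X b) = 0) :
    AvgCondPrintS F n K h V U₀ X :=
  avgCondPrintS_of_mem_fibre_of_logChartTwS_eq_zero F h hε₀ (ten7_of_ten12 F hε₀.le hε₀') hε₁ hε₁' hU₀V hU₀ hX hU₁ hwin hlog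
    (hSU_of_regPr F h hε₀ hε₀' he he9 hU₀ hX hXe)

end T3

end Summit.QuantumFields.YangMills.Theorems.Prop7SymSliceWitness

end
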